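import Mathlib
import Literature.MathematicalPhysics.QuantumFieldTheory.UniformTorusClusteringProofs
import Summits.Ventures.LatticeQCDFlow.Scaling.TruncatedCorrelatorFloor

/-!
# LatticeQCDFlow / Scaling — hypothesis (LC) REDUCED to Haar-moment identities at `β = 0`,
# part 1 of item 122 (jet algebra at `0`; Haar moments and Taylor's theorem for `numZ`)

HONEST FRAMING: exact (Metropolis-corrected) sampling algorithms for lattice gauge theory;
figures of merit are autocorrelation/cost numbers at stated couplings and volumes; no
continuum-physics claim.

Custody note (lean-1 GEN-8, LEAD LINE 224 (G1)): theory2's item 122 `TruncatedJetReduction.lean`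
(HOME/lean/theory2/, 880ddcbfd1a3f2c7 / 422 l) exceeds the gate's 400-line limit and is landed as
TWO files with every declaration byte-identical: this file = its §1–§2, and
`Scaling/TruncatedJetReduction.lean` = its §3–§4 (which imports this file).  The item's own
description follows verbatim.

# LatticeQCDFlow / Scaling — hypothesis (LC) REDUCED to Haar-moment identities at `β = 0`
# (item 122; the analytic bookkeeping between item 120's (LC) and the combinatorial census)

HONEST FRAMING: exact (Metropolis-corrected) sampling algorithms for lattice gauge theory;
figures of merit are autocorrelation/cost numbers at stated couplings and volumes; no
continuum-physics claim.

Venture `LatticeQCDFlow` (cell pub-lqcd), topic `Scaling`, item 122 of HOME/THEORY-2.md §3.1 (hy) /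
§4 row T2-AM (v4.8).  Item 120 (`Scaling.TruncatedCorrelatorFloor`) turns the leading-coefficient
hypothesis (LC) — `torusTruncC ρ (L+1) F₁ F₂ v β − b βⁿ = O(β^{n+1})` at `β = 0` with one
`b ≠ 0`, one `n`, every large `L` — into the volume-uniform floor (U′); item 121
(`Scaling.CrossCutFloorOfLeadingCoeff`) types that floor as the venture's
`Conjectures.CrossCutCorrelatorFloor`.  (LC) is a statement about a quotient of entire functions
(`PlaqSystem.expect = numZ / partZ`).  This file removes the analysis from it: (LC) follows from
FINITELY MANY IDENTITIES AMONG HAAR MOMENTS of the `β = 0` (product Haar) measure,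
`plaqMoment S F W a = ∫ F · (Σ_{p ∈ W} s_p)^a dν`, namely the vanishing of the Taylor
coefficients of `g := numZ(F₁F₂)·partZ − numZ(F₁)·numZ(F₂)` below order `n` and the value `b` at
order `n`:
* `mul_sub_mul_isBigO_pow`, `div_sq_sub_isBigO_pow` — jet algebra at `0` for functions `ℂ → ℂ`
  (product of jets; division by `Z²` with `Z(0) = 1`, `Z` differentiable at `0`);
* `numZ_sub_plaqTaylor_isBigO` — Taylor's theorem with remainder for
  `numZ F W β = ∫ F exp(−β Σ_{p∈W} s_p) dν` (`PlaqSystem.numZ_eq_integral_exp`): for `F` bounded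
  measurable, `numZ F W β − Σ_{a ≤ n} ((−1)^a/a!) plaqMoment_a βᵃ = O(β^{n+1})` (pointwise
  `‖exp x − Σ_{a ≤ n} xᵃ/a!‖ ≤ ‖x‖^{n+1} e^{‖x‖}`, `Complex.norm_exp_sub_sum_le_norm_mul_exp`,
  integrated against the probability measure `zdHaar`);
* `sum_coeff_pow_sub_isBigO` — a product of two Taylor polynomials whose convolved coefficients
  vanish below order `n` and equal `b` at order `n` is `b βⁿ + O(β^{n+1})`;
* `PlaqSystem.truncated_leadingCoeff_of_moments` (division step over the tree's
  `PlaqSystem.expect_mul_sub_eq_div`, `PlaqSystem.partZ_zero`,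
  `PlaqSystem.differentiable_numZ/partZ`) — for a regular plaquette system `S`, a finite
  label set `W` and bounded measurable `F₁, F₂`: IF for every `k ≤ n`
  `Σ_{a+c=k} (plaqCoeff (F₁F₂) a · plaqCoeff 1 c − plaqCoeff F₁ a · plaqCoeff F₂ c) = b·[k = n]`
  (`plaqCoeff F a := (−1)^a/a! · plaqMoment F a`), THEN
  `⟨F₁F₂⟩_W(β) − ⟨F₁⟩_W(β)⟨F₂⟩_W(β) − b βⁿ = O(β^{n+1})` at `β = 0`;
* `torusTruncC_leadingCoeff_of_moments` — the same for item 120's `torusTruncC ρ L' F₁ F₂ x`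
  (the torus plaquette system `torusSystem ρ L'`, labels `torusGenuine d L'`, observables read
  through `torusRed L'`): hypothesis (LC) of items 120/121 ⇐ the moment identities (MI).
CONSEQUENCE: the successor's target (LC) (HOME/lean/theory2/LANDING.md §32–§33: two parallel
plaquettes at distance `t = 2R+1`, `n = 4t`, `b = 2^{-(4t+1)} N^{-4t}` for `U(1)` / `SU(N)`,
`N ≥ 3`) is now the purely combinatorial census (MI) of Haar integrals
`∫ P₀ (P₀∘θ_v) (Σ_p s_p)^a dν`, `∫ P₀ (Σ_p s_p)^a dν`, `∫ (Σ_p s_p)^a dν`,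
`a ≤ 4t`, on the torus of side `L+1 ≥ L₀` (`v = t·e_a`; `P₀∘θ_v` is the plaquette at `−v`) —
the free-bond lemma (a bond covered by exactly one plaquette character integrates to zero) and
the count of the minimal tube [cite: MontvayMunster1994, §3.6.2 eq. (3.437)],
[cite: Schor1984, Thm 3.1–3.2]; no holomorphy, no quotients, no `O`-constants.
LITERATURE GRADE (honest): textbook mechanism (strong-coupling / high-temperature expansion of a
truncated correlation = expansion of numerator and denominator at `β = 0`
[cite: SeilerLNP1982, Ch. 2–3]); new = kernel-checked, for the tree's abstract `PlaqSystem` and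
its torus instance, with the exact interface (MI) the census must meet.

References: E. Seiler, LNP 159 (1982) Ch. 2–3 [SeilerLNP1982]; K. Osterwalder, E. Seiler, Ann.
Phys. 110 (1978) 440, §3 [OsterwalderSeilerAnnPhys1978]; I. Montvay, G. Münster, *Quantum Fields
on a Lattice* (1994) §3.6.2 [MontvayMunster1994]; R. Schor, Commun. Math. Phys. 92 (1984) 369–395
[Schor1984].  Elementary given the tree; farm `lean check` rc 0, no `sorry`.
-/

noncomputable section

open MeasureTheory Filter Asymptotics Finset
open scoped Topology Nat
open Literature.MathematicalPhysics.QuantumFieldTheory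
open Literature.MathematicalPhysics.QuantumLattice (configShift)

namespace Summit.Ventures.LatticeQCDFlow.Theory2

/-! ## 1. Jet algebra at `0` for functions `ℂ → ℂ` -/

section Jet

/-- **Product of jets.**  `f − p = O(z^{n+1})`, `g − q = O(z^{n+1})`, `f` and `q` bounded near
`0` ⇒ `f g − p q = O(z^{n+1})`. [folklore] -/
theorem mul_sub_mul_isBigO_pow {f g p q : ℂ → ℂ} {n : ℕ}
    (hf : (fun z => f z - p z) =O[𝓝 (0 : ℂ)] fun z => z ^ (n + 1))
    (hg : (fun z => g z - q z) =O[𝓝 (0 : ℂ)] fun z => z ^ (n + 1))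
    (hfb : f =O[𝓝 (0 : ℂ)] fun _ => (1 : ℂ)) (hqb : q =O[𝓝 (0 : ℂ)] fun _ => (1 : ℂ)) :
    (fun z => f z * g z - p z * q z) =O[𝓝 (0 : ℂ)] fun z => z ^ (n + 1) := by
  have h1 := hfb.mul hg
  have h2 := hf.mul hqb
  simp only [one_mul, mul_one] at h1 h2
  exact (h1.add h2).congr_left fun z => by ring

/-- **Division by `Z²`, `Z(0) = 1`.**  `g − b zⁿ = O(z^{n+1})`, `Z` differentiable at `0` with
`Z 0 = 1` ⇒ `g / Z² − b zⁿ = O(z^{n+1})`. [folklore] -/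
theorem div_sq_sub_isBigO_pow {g Z : ℂ → ℂ} {b : ℂ} {n : ℕ}
    (hg : (fun z => g z - b * z ^ n) =O[𝓝 (0 : ℂ)] fun z => z ^ (n + 1))
    (hZ : DifferentiableAt ℂ Z 0) (hZ0 : Z 0 = 1) :
    (fun z => g z / Z z ^ 2 - b * z ^ n) =O[𝓝 (0 : ℂ)] fun z => z ^ (n + 1) := by
  have hZc : ContinuousAt Z 0 := hZ.continuousAt
  have hZt : Tendsto Z (𝓝 0) (𝓝 1) := by
    have h := hZc.tendsto
    rwa [hZ0] at h
  have hZO : Z =O[𝓝 (0 : ℂ)] fun _ => (1 : ℂ) := hZt.isBigO_one ℂ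
  have hinv : Tendsto (fun z => (Z z ^ 2)⁻¹) (𝓝 0) (𝓝 1) := by
    have h := (hZt.pow 2).inv₀ (by norm_num)
    simpa using h
  have hinvO : (fun z => (Z z ^ 2)⁻¹) =O[𝓝 (0 : ℂ)] fun _ => (1 : ℂ) := hinv.isBigO_one ℂ
  have h1mZ : (fun z => 1 - Z z ^ 2) =O[𝓝 (0 : ℂ)] fun z => z := by
    have hsub : (fun z => Z z - Z 0) =O[𝓝 (0 : ℂ)] fun z => z - 0 := hZ.isBigO_sub
    have hadd : (fun z => Z z + 1) =O[𝓝 (0 : ℂ)] fun _ => (1 : ℂ) :=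
      hZO.add (isBigO_const_const (1 : ℂ) (one_ne_zero : (1 : ℂ) ≠ 0) _)
    have h := hsub.mul hadd
    simp only [sub_zero, mul_one] at h
    exact h.neg_left.congr_left fun z => by rw [hZ0]; ring
  have hmid : (fun z => b * z ^ n * (1 - Z z ^ 2)) =O[𝓝 (0 : ℂ)] fun z => z ^ (n + 1) := by
    have h := (isBigO_const_mul_self b (fun z : ℂ => z ^ n) (𝓝 (0 : ℂ))).mul h1mZ
    simpa [pow_succ] using h
  have hsum := hinvO.mul (hg.add hmid)
  simp only [one_mul] at hsum
  refine hsum.congr' ?_ EventuallyEq.rfl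
  filter_upwards [hZc.eventually_ne (by rw [hZ0]; exact one_ne_zero)] with z hz
  have h2 : (Z z ^ 2)⁻¹ * Z z ^ 2 = 1 := inv_mul_cancel₀ (pow_ne_zero _ hz)
  rw [div_eq_mul_inv]
  linear_combination (-(b * z ^ n)) * h2

/-- **Convolved coefficients.**  If `Σ_{a+c=k} e(a,c) = b·[k = n]` for every `k ≤ n`, then
`Σ_{a ≤ n} Σ_{c ≤ n} e(a,c) z^{a+c} − b zⁿ = O(z^{n+1})` at `0`. [folklore] -/
theorem sum_coeff_pow_sub_isBigO {e : ℕ → ℕ → ℂ} {b : ℂ} {n : ℕ}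
    (he : ∀ k ≤ n, ∑ ac ∈ antidiagonal k, e ac.1 ac.2 = if k = n then b else 0) :
    (fun z : ℂ => ∑ a ∈ range (n + 1), ∑ c ∈ range (n + 1), e a c * z ^ (a + c) - b * z ^ n)
      =O[𝓝 (0 : ℂ)] fun z => z ^ (n + 1) := by
  classical
  set P : Finset (ℕ × ℕ) := range (n + 1) ×ˢ range (n + 1) with hP
  -- the low part is `b zⁿ`
  have hfib : ∀ k ∈ range (n + 1),
      (P.filter (fun ac => ac.1 + ac.2 ≤ n)).filter (fun ac => ac.1 + ac.2 = k) =
        antidiagonal k := by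
    intro k hk
    have hk' := mem_range.1 hk
    ext ⟨a, c⟩
    simp only [mem_filter, hP, mem_product, mem_range, HasAntidiagonal.mem_antidiagonal]
    constructor
    · rintro ⟨-, h⟩; exact h
    · intro h; refine ⟨⟨⟨?_, ?_⟩, ?_⟩, h⟩ <;> omega
  have hlow : ∀ z : ℂ, ∑ ac ∈ P.filter (fun ac => ac.1 + ac.2 ≤ n), e ac.1 ac.2 * z ^ (ac.1 + ac.2)
      = b * z ^ n := by
    intro z
    rw [← Finset.sum_fiberwise_of_maps_to (s := P.filter (fun ac => ac.1 + ac.2 ≤ n))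
      (g := fun ac : ℕ × ℕ => ac.1 + ac.2) (t := range (n + 1))
      (fun ac hac => mem_range.2 (Nat.lt_succ_of_le (mem_filter.1 hac).2))]
    calc ∑ k ∈ range (n + 1), ∑ ac ∈ (P.filter (fun ac => ac.1 + ac.2 ≤ n)).filter
            (fun ac => ac.1 + ac.2 = k), e ac.1 ac.2 * z ^ (ac.1 + ac.2)
        = ∑ k ∈ range (n + 1), (∑ ac ∈ antidiagonal k, e ac.1 ac.2) * z ^ k := by
          refine sum_congr rfl fun k hk => ?_
          rw [hfib k hk, sum_mul]
          refine sum_congr rfl fun ac hac => ?_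
          rw [HasAntidiagonal.mem_antidiagonal.1 hac]
      _ = ∑ k ∈ range (n + 1), (if k = n then b else 0) * z ^ k :=
          sum_congr rfl fun k hk => by rw [he k (Nat.le_of_lt_succ (mem_range.1 hk))]
      _ = b * z ^ n := by simp [Finset.sum_ite_eq', ite_mul]
  -- each high term is `O(z^{n+1})`
  have hhigh : (fun z : ℂ => ∑ ac ∈ P.filter (fun ac => ¬ ac.1 + ac.2 ≤ n),
      e ac.1 ac.2 * z ^ (ac.1 + ac.2)) =O[𝓝 (0 : ℂ)] fun z => z ^ (n + 1) := by
    refine IsBigO.sum fun ac hac => ?_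
    have hlt : n + 1 ≤ ac.1 + ac.2 := by have := (mem_filter.1 hac).2; omega
    obtain ⟨m, hm⟩ := Nat.exists_eq_add_of_le hlt
    have hzm : (fun z : ℂ => z ^ m) =O[𝓝 (0 : ℂ)] fun _ => (1 : ℂ) :=
      ((continuous_pow m).tendsto (0 : ℂ)).isBigO_one ℂ
    have h := ((isBigO_refl (fun z : ℂ => z ^ (n + 1)) (𝓝 (0 : ℂ))).mul hzm).const_mul_left
      (e ac.1 ac.2)
    simp only [mul_one] at h
    refine h.congr_left fun z => ?_
    rw [hm]
    ring
  -- split the square `range (n+1) × range (n+1)` into low and high parts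
  have hsplit : ∀ z : ℂ, ∑ a ∈ range (n + 1), ∑ c ∈ range (n + 1), e a c * z ^ (a + c) =
      ∑ ac ∈ P.filter (fun ac => ac.1 + ac.2 ≤ n), e ac.1 ac.2 * z ^ (ac.1 + ac.2) +
        ∑ ac ∈ P.filter (fun ac => ¬ ac.1 + ac.2 ≤ n), e ac.1 ac.2 * z ^ (ac.1 + ac.2) := by
    intro z
    rw [Finset.sum_filter_add_sum_filter_not, hP, Finset.sum_product]
  refine hhigh.congr_left fun z => ?_
  rw [hsplit z, hlow z]
  ring

end Jet

/-! ## 2. Haar moments and the Taylor expansion of `numZ` at `β = 0` -/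

section Moments

variable {d : ℕ} {G : Type*} {ι : Type*} [Group G] [TopologicalSpace G] [IsTopologicalGroup G]
  [CompactSpace G] [MeasurableSpace G] [BorelSpace G]

/-- **Haar moment** of order `a` of the observable `F` against the total cost of the labels `W`:
`plaqMoment S F W a = ∫ F(U) · (Σ_{p ∈ W} s_p(U))^a dν(U)`, `ν` the product Haar measure
(`β = 0`). [folklore] -/
def plaqMoment (S : PlaqSystem d G ι) (F : ZdGaugeConfig d G → ℂ) (W : Finset ι) (a : ℕ) : ℂ :=
  ∫ U, F U * (∑ p ∈ W, (S.cost p U : ℂ)) ^ a ∂(zdHaar d G)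

/-- **Taylor coefficient** of order `a` of `β ↦ numZ F W β` at `β = 0`:
`plaqCoeff S F W a = (−1)^a / a! · plaqMoment S F W a`. [folklore] -/
def plaqCoeff (S : PlaqSystem d G ι) (F : ZdGaugeConfig d G → ℂ) (W : Finset ι) (a : ℕ) : ℂ :=
  (-1) ^ a / (a ! : ℂ) * plaqMoment S F W a

/-- **Taylor polynomial** of order `n` of `β ↦ numZ F W β` at `β = 0`. [folklore] -/
def plaqTaylor (S : PlaqSystem d G ι) (F : ZdGaugeConfig d G → ℂ) (W : Finset ι) (n : ℕ)
    (β : ℂ) : ℂ :=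
  ∑ a ∈ range (n + 1), plaqCoeff S F W a * β ^ a

variable {S : PlaqSystem d G ι} {M : ℝ} {D : ℕ}

/-- **Taylor's theorem for `numZ` at `β = 0`.**  For a regular system and a bounded measurable
observable, `numZ F W β − plaqTaylor S F W n β = O(β^{n+1})` at `0`. [folklore] -/
theorem numZ_sub_plaqTaylor_isBigO (hR : S.Regular M D) {F : ZdGaugeConfig d G → ℂ}
    (hFm : Measurable F) {C : ℝ} (hFb : ∀ U, ‖F U‖ ≤ C) (W : Finset ι) (n : ℕ) :
    (fun β => S.numZ F W β - plaqTaylor S F W n β) =O[𝓝 (0 : ℂ)] fun β => β ^ (n + 1) := by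
  classical
  set T : ZdGaugeConfig d G → ℂ := fun U => ∑ p ∈ W, (S.cost p U : ℂ) with hT
  have hTm : Measurable T :=
    Finset.measurable_sum _ fun p _ => Complex.measurable_ofReal.comp (hR.measurable_cost p)
  set Lb : ℝ := W.card * M with hLb
  have hM0 : 0 ≤ M := hR.pos.le
  have hLb0 : 0 ≤ Lb := by positivity
  have hTb : ∀ U, ‖T U‖ ≤ Lb := by
    intro U
    refine (norm_sum_le _ _).trans ?_
    calc ∑ p ∈ W, ‖(S.cost p U : ℂ)‖ ≤ ∑ p ∈ W, M := Finset.sum_le_sum fun p _ => by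
            rw [Complex.norm_real, Real.norm_eq_abs]; exact hR.abs_cost_le p U
      _ = Lb := by simp [hLb]
  have hC0 : 0 ≤ C := (norm_nonneg _).trans (hFb fun _ => 1)
  -- the remainder integrand and its bound
  set Rm : ℂ → ZdGaugeConfig d G → ℂ := fun β U =>
    F U * (Complex.exp (-(β * T U)) - ∑ a ∈ range (n + 1), (-(β * T U)) ^ a / (a ! : ℂ)) with hRm
  have hRm_eq : ∀ β, S.numZ F W β - plaqTaylor S F W n β = ∫ U, Rm β U ∂(zdHaar d G) := by
    intro β
    have hterm : ∀ a : ℕ,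
        Integrable (fun U => F U * ((-(β * T U)) ^ a / (a ! : ℂ))) (zdHaar d G) := by
      intro a
      refine integrable_of_norm_le (hFm.mul (((hTm.const_mul β).neg.pow_const a).div_const _))
        (C * ((‖β‖ * Lb) ^ a / (a ! : ℝ))) fun U => ?_
      rw [norm_mul, norm_div, norm_pow, norm_neg, norm_mul, Complex.norm_natCast]
      refine mul_le_mul (hFb U) ?_ (by positivity) hC0
      gcongr
      exact hTb U
    have hexpI : Integrable (fun U => F U * Complex.exp (-(β * T U))) (zdHaar d G) := by
      refine integrable_of_norm_le (hFm.mul (Complex.measurable_exp.comp (hTm.const_mul β).neg))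
        (C * Real.exp (‖β‖ * Lb)) fun U => ?_
      rw [norm_mul]
      refine mul_le_mul (hFb U) ?_ (norm_nonneg _) hC0
      refine (Complex.norm_exp_le_exp_norm _).trans (Real.exp_le_exp.2 ?_)
      rw [norm_neg, norm_mul]
      exact mul_le_mul_of_nonneg_left (hTb U) (norm_nonneg _)
    have htaylor : plaqTaylor S F W n β =
        ∫ U, ∑ a ∈ range (n + 1), F U * ((-(β * T U)) ^ a / (a ! : ℂ)) ∂(zdHaar d G) := by
      rw [integral_finsetSum _ fun a _ => hterm a]
      simp only [plaqTaylor, plaqCoeff, plaqMoment, hT]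
      refine sum_congr rfl fun a _ => ?_
      rw [← integral_const_mul, ← integral_mul_const]
      refine integral_congr_ae (Eventually.of_forall fun U => ?_)
      dsimp only
      rw [neg_pow (β * _), mul_pow]
      ring
    have hnum : S.numZ F W β = ∫ U, F U * Complex.exp (-(β * T U)) ∂(zdHaar d G) := by
      rw [S.numZ_eq_integral_exp]
    rw [hnum, htaylor, ← integral_sub hexpI (integrable_finsetSum _ fun a _ => hterm a)]
    refine integral_congr_ae (Eventually.of_forall fun U => ?_)
    simp only [hRm, mul_sub, Finset.mul_sum]
  -- pointwise remainder bound on the ball `‖β‖ ≤ 1 / (Lb + 1)`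
  have hball : ∀ᶠ β : ℂ in 𝓝 0, ‖β‖ ≤ 1 / (Lb + 1) := by
    have h : Metric.closedBall (0 : ℂ) (1 / (Lb + 1)) ∈ 𝓝 (0 : ℂ) :=
      Metric.closedBall_mem_nhds _ (by positivity)
    filter_upwards [h] with β hβ
    simpa using hβ
  refine IsBigO.of_bound (C * (Lb ^ (n + 1) * Real.exp 1)) ?_
  filter_upwards [hball] with β hβ
  have hβLb : ‖β‖ * Lb ≤ 1 := by
    calc ‖β‖ * Lb ≤ 1 / (Lb + 1) * Lb := mul_le_mul_of_nonneg_right hβ hLb0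
      _ ≤ 1 := by
          rw [div_mul_eq_mul_div, one_mul]
          exact (div_le_one (by positivity)).2 (by linarith)
  have hpt : ∀ U, ‖Rm β U‖ ≤ C * (Lb ^ (n + 1) * Real.exp 1) * ‖β‖ ^ (n + 1) := by
    intro U
    have hx : ‖-(β * T U)‖ ≤ ‖β‖ * Lb := by
      rw [norm_neg, norm_mul]; exact mul_le_mul_of_nonneg_left (hTb U) (norm_nonneg _)
    have hx1 : ‖-(β * T U)‖ ≤ 1 := hx.trans hβLb
    have hrem := Complex.norm_exp_sub_sum_le_norm_mul_exp (-(β * T U)) (n + 1)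
    rw [hRm, norm_mul]
    calc ‖F U‖ * ‖Complex.exp (-(β * T U)) - ∑ a ∈ range (n + 1), (-(β * T U)) ^ a / (a ! : ℂ)‖
        ≤ C * (‖-(β * T U)‖ ^ (n + 1) * Real.exp ‖-(β * T U)‖) :=
          mul_le_mul (hFb U) hrem (norm_nonneg _) hC0
      _ ≤ C * ((‖β‖ * Lb) ^ (n + 1) * Real.exp 1) :=
          mul_le_mul_of_nonneg_left (mul_le_mul (pow_le_pow_left₀ (norm_nonneg _) hx _)
            (Real.exp_le_exp.2 hx1) (Real.exp_pos _).le (by positivity)) hC0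
      _ = C * (Lb ^ (n + 1) * Real.exp 1) * ‖β‖ ^ (n + 1) := by ring
  rw [hRm_eq β, norm_pow]
  have hI := norm_integral_le_of_norm_le_const (μ := zdHaar d G) (Eventually.of_forall hpt)
  simpa using hI

end Moments

end Summit.Ventures.LatticeQCDFlow.Theory2

end
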